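import Literature.NumberTheory.EllipticCurves.RealLatticePeriod
import Mathlib.Analysis.Complex.RealDeriv
import Mathlib.Analysis.Calculus.Deriv.MeanValue
import Mathlib.Analysis.Calculus.LocalExtr.Basic
import Mathlib.Analysis.Analytic.Uniqueness
import Mathlib.Analysis.SpecialFunctions.ExpDeriv
import Mathlib.MeasureTheory.Function.JacobianOneDim
import Mathlib.MeasureTheory.Measure.Lebesgue.Basic
import HarnessLib

/-!
# Monotonicity of `℘` of a real lattice on the real half-period; the unbounded component

Discharges (D-0014 sibling `…Proofs` file) of two of the named facts of
`Literature/NumberTheory/EllipticCurves/RealLatticePeriod.lean` for a real lattice `Λ` with least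
positive real period `Ω₀` (`PeriodPair.minRealPeriod`), `e₁ = ℘(Ω₀/2)`, `f(x) = 4x³ − g₂x − g₃`:

* `PeriodPair.IsReal.strictAntiOn_weierstrassP_holds` (Lawden §6.11, §6.15): `t ↦ ℘(t)` is
  strictly decreasing on `(0, Ω₀/2]` and tends to `+∞` at `0⁺`;
* `PeriodPair.IsReal.integral_Ioi_inv_sqrt_cubic_holds` (Lawden (6.12.4), (6.17.4)):
  `∫_{e₁}^{∞} dx/√f(x) = Ω₀/2`.

Lawden reads the monotonicity off the mapping properties of `℘` on the period rectangle; we give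
an elementary real-variable proof using only Mathlib's `℘'² = f(℘)`
(`PeriodPair.derivWeierstrassP_sq`) and analyticity:

1. `℘`, `℘'` are real on `ℝ ∖ Λ` (from `RealLatticePeriod.lean`), `re ℘ → +∞`, `re ℘' → −∞` at
   `0⁺` (`tendsto_weierstrassPRe_nhdsGT_zero`, `tendsto_derivWeierstrassPRe_nhdsGT_zero`), and
   `℘'(Ω₀/2) = 0`.
2. `IsReal.derivWeierstrassPRe_neg`: `℘' < 0` on `(0, Ω₀/2)`.  Let `a` be the first zero of `℘'`
   in `(0, Ω₀/2]`; if `a < Ω₀/2`, look at the extrema of `℘` on `[a, Ω₀ − a]` (symmetric under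
   `t ↦ Ω₀ − t`): an interior extremum `b` gives a second root `℘(b)` of `f` next to the root
   `e = ℘(a)` with `f ≥ 0` in between, forcing a double root (`cubic_eq_of_roots_of_nonneg`), and
   then the Grönwall-type lemma `eq_of_abs_deriv_le_mul_abs_sub` (`|℘'| = √f(℘) ≤ C|℘ − root|`)
   makes `℘` constant on an interval — impossible for a non-constant analytic function
   (`IsReal.not_derivWeierstrassPRe_eq_zero_on_Ioo`); no interior extremum makes `℘` constant on
   `[a, Ω₀ − a]` outright.
3. `strictAntiOn_of_deriv_neg` gives the monotonicity; the image of `(0, Ω₀/2)` is `(e₁, ∞)`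
   (`IsReal.image_weierstrassPRe_Ioo`), and the change of variables `x = ℘(t)`
   (`MeasureTheory.integral_image_eq_integral_abs_deriv_smul`, `|℘'|/√f(℘) = 1`) gives the
   integral.

## References

* D. F. Lawden, *Elliptic Functions and Applications*, Applied Math. Sciences 80, Springer 1989,
  §6.11, eqs. (6.12.3)–(6.12.4), §6.15, eq. (6.17.4).
* E. T. Whittaker, G. N. Watson, *A Course of Modern Analysis*, §20.32, §20.33.
-/

noncomputable section

open scoped ComplexConjugate Topology
open Filter Set MeasureTheory

namespace PeriodPair

variable {L : PeriodPair}

/-! ### Calculus for `℘` and `℘'` on the real axis -/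

/-- A real number strictly between `0` and the least positive real period is not a lattice point.
[folklore] -/
lemma IsReal.ofReal_notMem_lattice (h : L.IsReal) {t : ℝ} (h0 : 0 < t)
    (h1 : t < L.minRealPeriod) : (t : ℂ) ∉ L.lattice :=
  fun ht ↦ (h.minRealPeriod_le ⟨h0, ht⟩).not_gt h1

/-- `℘` has complex derivative `℘'` off the lattice. [folklore] -/
lemma hasDerivAt_weierstrassP {z : ℂ} (hz : z ∉ L.lattice) : HasDerivAt ℘[L] (℘'[L] z) z := by
  have hd : DifferentiableAt ℂ ℘[L] z :=
    L.differentiableOn_weierstrassP.differentiableAt (L.isClosed_lattice.isOpen_compl.mem_nhds hz)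
  simpa using hd.hasDerivAt

/-- `t ↦ re ℘(t)` has derivative `re ℘'(t)` at real non-lattice points. [folklore] -/
lemma hasDerivAt_weierstrassPRe {t : ℝ} (ht : (t : ℂ) ∉ L.lattice) :
    HasDerivAt L.weierstrassPRe (L.derivWeierstrassPRe t) t :=
  (hasDerivAt_weierstrassP ht).real_of_complex

/-- `t ↦ re ℘'(t)` is differentiable (in particular continuous) at real non-lattice points.
[folklore] -/
lemma differentiableAt_derivWeierstrassPRe {t : ℝ} (ht : (t : ℂ) ∉ L.lattice) :
    DifferentiableAt ℝ L.derivWeierstrassPRe t := by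
  have hd : DifferentiableAt ℂ ℘'[L] t :=
    L.differentiableOn_derivWeierstrassP.differentiableAt
      (L.isClosed_lattice.isOpen_compl.mem_nhds ht)
  exact hd.hasDerivAt.real_of_complex.differentiableAt

/-- `t ↦ re ℘'(t)` is continuous at real non-lattice points. [folklore] -/
lemma continuousAt_derivWeierstrassPRe {t : ℝ} (ht : (t : ℂ) ∉ L.lattice) :
    ContinuousAt L.derivWeierstrassPRe t :=
  (differentiableAt_derivWeierstrassPRe ht).continuousAt

/-- `t ↦ re ℘(t)` is continuous at real non-lattice points. [folklore] -/
lemma continuousAt_weierstrassPRe {t : ℝ} (ht : (t : ℂ) ∉ L.lattice) :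
    ContinuousAt L.weierstrassPRe t :=
  (hasDerivAt_weierstrassPRe ht).continuousAt

/-- The differential equation on the real axis: `(re ℘')² = 4(re ℘)³ − g₂ re ℘ − g₃` for a real
lattice (real form of Mathlib's `PeriodPair.derivWeierstrassP_sq`; Lawden (6.7.26)). [folklore] -/
lemma IsReal.derivWeierstrassPRe_sq (h : L.IsReal) {t : ℝ} (ht : (t : ℂ) ∉ L.lattice) :
    L.derivWeierstrassPRe t ^ 2 =
      4 * L.weierstrassPRe t ^ 3 - L.g₂.re * L.weierstrassPRe t - L.g₃.re := by
  have := L.derivWeierstrassP_sq t ht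
  rw [← h.ofReal_weierstrassPRe, ← h.ofReal_derivWeierstrassPRe, ← h.ofReal_g₂_re,
    ← h.ofReal_g₃_re] at this
  exact_mod_cast this

/-- Symmetry about the half-period: `℘(Ω₀ − t) = ℘(t)`. [folklore] -/
lemma IsReal.weierstrassPRe_minRealPeriod_sub (h : L.IsReal) (t : ℝ) :
    L.weierstrassPRe (L.minRealPeriod - t) = L.weierstrassPRe t := by
  simp only [weierstrassPRe]
  have := L.weierstrassP_add_coe (-(t : ℂ)) ⟨_, h.minRealPeriod_mem_lattice⟩
  rw [L.weierstrassP_neg] at this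
  rw [← this]
  congr 1; push_cast; ring

/-- Antisymmetry of `℘'` about the half-period: `℘'(Ω₀ − t) = −℘'(t)`. [folklore] -/
lemma IsReal.derivWeierstrassPRe_minRealPeriod_sub (h : L.IsReal) (t : ℝ) :
    L.derivWeierstrassPRe (L.minRealPeriod - t) = -L.derivWeierstrassPRe t := by
  simp only [derivWeierstrassPRe]
  have := L.derivWeierstrassP_add_coe (-(t : ℂ)) ⟨_, h.minRealPeriod_mem_lattice⟩
  rw [L.derivWeierstrassP_neg] at this
  rw [← Complex.neg_re, ← this]
  congr 2; push_cast; ring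

/-- `re ℘(t) → +∞` as `t → 0⁺` (double pole, `℘(z) − z⁻²` is analytic at `0`). [folklore] -/
lemma tendsto_weierstrassPRe_nhdsGT_zero :
    Tendsto L.weierstrassPRe (𝓝[>] 0) atTop := by
  have hcont : ContinuousAt (L.weierstrassPExcept 0) 0 :=
    (L.analyticAt_weierstrassPExcept 0).continuousAt
  -- `re ℘(t) = re ℘[L-0](t) + t⁻¹ ^ 2`
  have heq : ∀ t : ℝ, L.weierstrassPRe t = (L.weierstrassPExcept 0 t).re + (t⁻¹) ^ 2 := by
    intro t
    have := L.weierstrassPExcept_add ⟨0, zero_mem _⟩ t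
    simp only [sub_zero, ne_eq, OfNat.ofNat_ne_zero, not_false_eq_true,
      zero_pow, div_zero] at this
    rw [weierstrassPRe, ← this, Complex.add_re]
    congr 1
    rw [show (1 / (t : ℂ) ^ 2 : ℂ) = ((t⁻¹ ^ 2 : ℝ) : ℂ) by push_cast; ring, Complex.ofReal_re]
  simp only [funext heq]
  refine Tendsto.add_atTop (C := (L.weierstrassPExcept 0 0).re) ?_ ?_
  · have : Tendsto (fun t : ℝ ↦ (L.weierstrassPExcept 0 t).re) (𝓝 0)
        (𝓝 (L.weierstrassPExcept 0 0).re) := by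
      have h1 : ContinuousAt (fun t : ℝ ↦ (L.weierstrassPExcept 0 t).re) 0 :=
        (Complex.continuous_re.continuousAt.comp
          (by simpa using hcont)).comp Complex.continuous_ofReal.continuousAt
      simpa using h1.tendsto
    exact this.mono_left nhdsWithin_le_nhds
  · exact (tendsto_pow_atTop two_ne_zero).comp tendsto_inv_nhdsGT_zero

/-- `re ℘'(t) → −∞` as `t → 0⁺` (triple pole, `℘'(z) + 2z⁻³` is analytic at `0`). [folklore] -/
lemma tendsto_derivWeierstrassPRe_nhdsGT_zero :
    Tendsto L.derivWeierstrassPRe (𝓝[>] 0) atBot := by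
  have hcont : ContinuousAt (L.derivWeierstrassPExcept 0) 0 :=
    (L.analyticAt_derivWeierstrassPExcept 0).continuousAt
  have heq : ∀ t : ℝ,
      L.derivWeierstrassPRe t = (L.derivWeierstrassPExcept 0 t).re + (-2) * (t⁻¹) ^ 3 := by
    intro t
    have := L.derivWeierstrassPExcept_sub ⟨0, zero_mem _⟩ t
    simp only [sub_zero] at this
    rw [derivWeierstrassPRe, ← this, Complex.sub_re]
    rw [show (2 / (t : ℂ) ^ 3 : ℂ) = ((2 * t⁻¹ ^ 3 : ℝ) : ℂ) by push_cast; ring, Complex.ofReal_re]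
    ring
  simp only [funext heq]
  refine Tendsto.add_atBot (C := (L.derivWeierstrassPExcept 0 0).re) ?_ ?_
  · have h1 : ContinuousAt (fun t : ℝ ↦ (L.derivWeierstrassPExcept 0 t).re) 0 :=
      (Complex.continuous_re.continuousAt.comp
        (by simpa using hcont)).comp Complex.continuous_ofReal.continuousAt
    simpa using h1.tendsto.mono_left nhdsWithin_le_nhds
  · exact ((tendsto_pow_atTop three_ne_zero).comp tendsto_inv_nhdsGT_zero).const_mul_atTop_of_neg
      (by norm_num)

/-! ### Three auxiliary lemmas -/

/-- A one-dimensional Grönwall/uniqueness lemma: if `|p'| ≤ C |p − e|` on `[c, d]` and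
`p(d) = e`, then `p ≡ e` on `[c, d]`. [folklore] -/
lemma eq_of_abs_deriv_le_mul_abs_sub {p p' : ℝ → ℝ} {c d e C : ℝ}
    (hderiv : ∀ t ∈ Icc c d, HasDerivAt p (p' t) t)
    (hbound : ∀ t ∈ Icc c d, |p' t| ≤ C * |p t - e|) (hd : p d = e) :
    ∀ t ∈ Icc c d, p t = e := by
  -- `φ t = (p t - e)² · exp (2Ct)` is nondecreasing on `[c, d]` and vanishes at `d`
  set φ : ℝ → ℝ := fun t ↦ (p t - e) ^ 2 * Real.exp (2 * C * t) with hφ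
  have hφd : ∀ t ∈ Icc c d, HasDerivAt φ
      (2 * (p t - e) * p' t * Real.exp (2 * C * t) +
        (p t - e) ^ 2 * (Real.exp (2 * C * t) * (2 * C))) t := by
    intro t ht
    have h1 : HasDerivAt (fun t ↦ (p t - e) ^ 2) (2 * (p t - e) * p' t) t :=
      (((hderiv t ht).sub_const e).fun_pow 2).congr_deriv (by push_cast; ring)
    have h2 : HasDerivAt (fun t ↦ Real.exp (2 * C * t)) (Real.exp (2 * C * t) * (2 * C)) t := by
      have h3 : HasDerivAt (fun t : ℝ ↦ 2 * C * t) (2 * C) t := by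
        simpa using (hasDerivAt_id' t).const_mul (2 * C)
      exact (Real.hasDerivAt_exp _).comp t h3
    exact h1.fun_mul h2
  have hmono : MonotoneOn φ (Icc c d) := by
    refine monotoneOn_of_deriv_nonneg (convex_Icc c d)
      (fun t ht ↦ (hφd t ht).continuousAt.continuousWithinAt)
      (fun t ht ↦ (hφd t (interior_subset ht)).differentiableAt.differentiableWithinAt) ?_
    intro t ht
    rw [(hφd t (interior_subset ht)).deriv]
    have hb := hbound t (interior_subset ht)
    have hexp : 0 < Real.exp (2 * C * t) := Real.exp_pos _
    have h1 : -(C * (p t - e) ^ 2) ≤ (p t - e) * p' t := by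
      have h2 : |(p t - e) * p' t| ≤ C * (p t - e) ^ 2 := by
        rw [abs_mul]
        calc |p t - e| * |p' t| ≤ |p t - e| * (C * |p t - e|) := by gcongr
          _ = C * (p t - e) ^ 2 := by rw [← sq_abs (p t - e)]; ring
      have := neg_abs_le ((p t - e) * p' t)
      linarith
    nlinarith
  intro t ht
  have hle : φ t ≤ φ d := hmono ht (right_mem_Icc.mpr (ht.1.trans ht.2)) ht.2
  have hφd0 : φ d = 0 := by simp [hφ, hd]
  have hnn : 0 ≤ φ t := by positivity
  have h0 : φ t = 0 := le_antisymm (hle.trans hφd0.le) hnn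
  rcases mul_eq_zero.mp h0 with h1 | h1
  · exact sub_eq_zero.mp (pow_eq_zero_iff two_ne_zero |>.mp h1)
  · exact absurd h1 (Real.exp_pos _).ne'

/-- If the real cubic `f(x) = 4x³ − Ax − B` has roots `u < v` and is nonnegative on `[u, ∞)`,
then `v` is a double root: `A = 12v²`, `B = −8v³` (so `f(x) = 4(x − v)²(x + 2v)`) and
`u = −2v`. [folklore] -/
lemma cubic_eq_of_roots_of_nonneg {A B u v : ℝ} (huv : u < v) (hu : 4 * u ^ 3 - A * u - B = 0)
    (hv : 4 * v ^ 3 - A * v - B = 0) (hnn : ∀ x, u ≤ x → 0 ≤ 4 * x ^ 3 - A * x - B) :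
    A = 12 * v ^ 2 ∧ B = -8 * v ^ 3 ∧ u = -2 * v := by
  -- `v` is a local minimum of `f`, so `f'(v) = 12v² − A = 0`
  have hmin : IsLocalMin (fun x ↦ 4 * x ^ 3 - A * x - B) v := by
    filter_upwards [lt_mem_nhds huv] with x hx
    rw [hv]
    exact hnn x hx.le
  have hderiv : HasDerivAt (fun x ↦ 4 * x ^ 3 - A * x - B) (12 * v ^ 2 - A) v :=
    ((((hasDerivAt_id' v).fun_pow 3).const_mul 4 |>.fun_sub
      ((hasDerivAt_id' v).const_mul A)).sub_const B).congr_deriv (by push_cast; ring)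
  have hA : 12 * v ^ 2 - A = 0 := hmin.hasDerivAt_eq_zero hderiv
  have hA' : A = 12 * v ^ 2 := by linarith
  have hB' : B = -8 * v ^ 3 := by rw [hA'] at hv; linarith
  refine ⟨hA', hB', ?_⟩
  have h1 : 4 * (u - v) ^ 2 * (u + 2 * v) = 0 := by
    rw [← hu, hA', hB']; ring
  have h2 : (u - v) ^ 2 ≠ 0 := pow_ne_zero 2 (sub_ne_zero.mpr huv.ne)
  have h3 : u + 2 * v = 0 := by
    rcases mul_eq_zero.mp h1 with h | h
    · exact absurd ((mul_eq_zero.mp h).resolve_left (by norm_num)) h2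
    · exact h
  linarith

/-- If `℘'` of a real lattice vanished on a real interval inside `(0, Ω₀)`, it would vanish on
all of `(0, Ω₀)` by analytic continuation, contradicting the pole at `0`. [folklore] -/
lemma IsReal.not_derivWeierstrassPRe_eq_zero_on_Ioo (h : L.IsReal) {a b : ℝ} (ha : 0 < a)
    (hab : a < b) (hb : b < L.minRealPeriod) (h0 : ∀ t ∈ Ioo a b, L.derivWeierstrassPRe t = 0) :
    False := by
  -- the real-analytic function `s ↦ ℘'(s)` on `(0, Ω₀)`
  set g : ℝ → ℂ := fun s ↦ ℘'[L] s with hg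
  have hga : AnalyticOnNhd ℝ g (Ioo 0 L.minRealPeriod) := by
    intro s hs
    have h1 : AnalyticAt ℂ ℘'[L] (s : ℂ) :=
      L.analyticOnNhd_derivWeierstrassP _ (h.ofReal_notMem_lattice hs.1 hs.2)
    exact h1.restrictScalars.comp (Complex.ofRealCLM.analyticAt s)
  have hz : g =ᶠ[𝓝 ((a + b) / 2)] 0 := by
    have : Ioo a b ∈ 𝓝 ((a + b) / 2) := Ioo_mem_nhds (by linarith) (by linarith)
    filter_upwards [this] with s hs
    change ℘'[L] s = 0
    rw [← h.ofReal_derivWeierstrassPRe, h0 s hs, Complex.ofReal_zero]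
  have hall : EqOn g 0 (Ioo 0 L.minRealPeriod) :=
    hga.eqOn_zero_of_preconnected_of_eventuallyEq_zero isPreconnected_Ioo
      ⟨by linarith, by linarith⟩ hz
  -- hence `re ℘' = 0` on `(0, Ω₀)`, contradicting `re ℘' → -∞` at `0⁺`
  have hev : ∀ᶠ t in 𝓝[>] (0 : ℝ), L.derivWeierstrassPRe t < -1 :=
    tendsto_derivWeierstrassPRe_nhdsGT_zero.eventually (eventually_lt_atBot (-1))
  have hev2 : ∀ᶠ t in 𝓝[>] (0 : ℝ), t < L.minRealPeriod :=
    mem_nhdsWithin_of_mem_nhds (Iio_mem_nhds h.minRealPeriod_pos)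
  have hev3 : ∀ᶠ t in 𝓝[>] (0 : ℝ), t ∈ Ioi 0 := eventually_mem_nhdsWithin
  obtain ⟨t, ht1, ht2, ht3⟩ := (hev.and (hev2.and hev3)).exists
  have := hall ⟨ht3, ht2⟩
  simp only [hg, Pi.zero_apply] at this
  have h4 : L.derivWeierstrassPRe t = 0 := by rw [derivWeierstrassPRe, this, Complex.zero_re]
  linarith

/-! ### `℘' < 0` on the open real half-period -/

/-- **Monotonicity of `℘` on the real half-period, derivative form** (Lawden §6.11 rectangular
case, §6.15 rhombic case): for a real lattice, `℘' < 0` on `(0, Ω₀/2)`.  Elementary proof: let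
`a` be the first zero of `℘'` in `(0, Ω₀/2]`; if `a < Ω₀/2`, study the extrema of `℘` on
`[a, Ω₀ − a]`: an interior extremum gives a second real root of `f = 4x³ − g₂x − g₃` next to
`e = ℘(a)` with `f ≥ 0` in between, forcing a double root, and then Grönwall's inequality
`|℘'| = √f(℘) ≤ C|℘ − root|` makes `℘` constant — contradiction; no interior extremum means `℘`
is constant on `[a, Ω₀ − a]`, contradicting analyticity. [folklore] -/
theorem IsReal.derivWeierstrassPRe_neg (h : L.IsReal) {t : ℝ} (ht0 : 0 < t)
    (ht1 : t < L.minRealPeriod / 2) : L.derivWeierstrassPRe t < 0 := by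
  set Ω := L.minRealPeriod with hΩ
  have hΩpos : 0 < Ω := h.minRealPeriod_pos
  set p := L.weierstrassPRe with hp
  set q := L.derivWeierstrassPRe with hq
  set f : ℝ → ℝ := fun x ↦ 4 * x ^ 3 - L.g₂.re * x - L.g₃.re with hf
  -- basic facts on `(0, Ω)`
  have hnot : ∀ s, 0 < s → s < Ω → (s : ℂ) ∉ L.lattice :=
    fun s h0 h1 ↦ h.ofReal_notMem_lattice h0 h1
  have hder : ∀ s, 0 < s → s < Ω → HasDerivAt p (q s) s :=
    fun s h0 h1 ↦ hasDerivAt_weierstrassPRe (hnot s h0 h1)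
  have hqcont : ∀ s, 0 < s → s < Ω → ContinuousAt q s :=
    fun s h0 h1 ↦ continuousAt_derivWeierstrassPRe (hnot s h0 h1)
  have hsq : ∀ s, 0 < s → s < Ω → q s ^ 2 = f (p s) :=
    fun s h0 h1 ↦ h.derivWeierstrassPRe_sq (hnot s h0 h1)
  have hqhalf : q (Ω / 2) = 0 := by
    have := h.derivWeierstrassP_minRealPeriod_div_two
    show (℘'[L] ((L.minRealPeriod / 2 : ℝ) : ℂ)).re = 0
    rw [this, Complex.zero_re]
  -- Step 1: `q < 0` near `0⁺`
  obtain ⟨ε, hε, hεΩ, hqε⟩ : ∃ ε, 0 < ε ∧ ε < Ω / 2 ∧ ∀ s, 0 < s → s ≤ ε → q s < 0 := by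
    have hev : ∀ᶠ s in 𝓝[>] (0 : ℝ), q s < 0 :=
      tendsto_derivWeierstrassPRe_nhdsGT_zero.eventually (eventually_lt_atBot 0)
    rw [eventually_nhdsWithin_iff, Metric.eventually_nhds_iff] at hev
    obtain ⟨δ, hδ, hδq⟩ := hev
    refine ⟨min (δ / 2) (Ω / 4), by positivity, ?_, fun s hs0 hs1 ↦ hδq ?_ hs0⟩
    · exact (min_le_right _ _).trans_lt (by linarith)
    · rw [Real.dist_eq, sub_zero, abs_of_pos hs0]
      exact (hs1.trans (min_le_left _ _)).trans_lt (by linarith)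
  -- Step 2: the first zero `a` of `q` in `[ε, Ω/2]`
  set Z : Set ℝ := {s | s ∈ Icc ε (Ω / 2) ∧ q s = 0} with hZ
  have hZne : Z.Nonempty := ⟨Ω / 2, ⟨hεΩ.le, le_rfl⟩, hqhalf⟩
  have hZclosed : IsClosed Z := by
    have hc : ContinuousOn q (Icc ε (Ω / 2)) := fun s hs ↦
      (hqcont s (hε.trans_le hs.1) (by linarith [hs.2])).continuousWithinAt
    exact hc.preimage_isClosed_of_isClosed isClosed_Icc isClosed_singleton
  have hZbdd : BddBelow Z := ⟨ε, fun s hs ↦ hs.1.1⟩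
  set a := sInf Z with ha
  have haZ : a ∈ Z := hZclosed.csInf_mem hZne hZbdd
  have hεa : ε ≤ a := haZ.1.1
  have haΩ : a ≤ Ω / 2 := haZ.1.2
  have hqa : q a = 0 := haZ.2
  have ha0 : 0 < a := hε.trans_le hεa
  -- `q ≠ 0`, hence `q < 0`, on `(0, a)`
  have hqne : ∀ s, 0 < s → s < a → q s ≠ 0 := by
    intro s hs0 hsa hqs
    by_cases hsε : s ≤ ε
    · exact (hqε s hs0 hsε).ne hqs
    · have hsZ : s ∈ Z := ⟨⟨(not_le.mp hsε).le, hsa.le.trans haΩ⟩, hqs⟩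
      exact (csInf_le hZbdd hsZ).not_gt hsa
  have hqneg : ∀ s, 0 < s → s < a → q s < 0 := by
    intro s hs0 hsa
    by_contra hcon
    have hpos : 0 < q s := lt_of_le_of_ne (not_lt.mp hcon) (hqne s hs0 hsa).symm
    set ε' := min ε (s / 2) with hε'
    have hε'0 : 0 < ε' := by positivity
    have hε's : ε' ≤ s := (min_le_right _ _).trans (by linarith)
    have hqε' : q ε' < 0 := hqε ε' hε'0 (min_le_left _ _)
    have hcont : ContinuousOn q (Icc ε' s) := fun r hr ↦
      (hqcont r (hε'0.trans_le hr.1) (by linarith [hr.2])).continuousWithinAt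
    obtain ⟨r, hr, hqr⟩ := intermediate_value_Icc hε's hcont ⟨hqε'.le, hpos.le⟩
    rcases hr.2.eq_or_lt with hrs | hrs
    · rw [hrs] at hqr; exact hpos.ne' hqr
    · exact hqne r (hε'0.trans_le hr.1) (hrs.trans hsa) hqr
  -- Step 3: it suffices to show `a = Ω/2`
  suffices haeq : a = Ω / 2 by exact hqneg t ht0 (haeq ▸ ht1)
  by_contra hane
  have halt : a < Ω / 2 := lt_of_le_of_ne haΩ hane
  -- notation: `e = p a`, `b = Ω − a`
  set e := p a with he
  set b := Ω - a with hb
  have hab : a < b := by linarith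
  have hbΩ : b < Ω := by linarith
  have hpb : p b = e := h.weierstrassPRe_minRealPeriod_sub a
  have hfe : f e = 0 := by rw [← hsq a ha0 (by linarith), hqa]; ring
  -- `p` is strictly decreasing on `(0, a]`
  have hpanti : StrictAntiOn p (Ioc 0 a) := by
    refine strictAntiOn_of_deriv_neg (convex_Ioc 0 a)
      (fun s hs ↦ (hder s hs.1 (by linarith [hs.2])).continuousAt.continuousWithinAt) ?_
    rw [interior_Ioc]
    intro s hs
    rw [(hder s hs.1 (by linarith [hs.2])).deriv]
    exact hqneg s hs.1 hs.2
  have hpge : ∀ s, 0 < s → s ≤ a → e ≤ p s :=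
    fun s hs0 hsa ↦ hpanti.antitoneOn ⟨hs0, hsa⟩ ⟨ha0, le_rfl⟩ hsa
  -- range: every `x ≥ e` is a value `p s`, `s ∈ (0, a]`, hence `f x ≥ 0`
  have hrange : ∀ x, e ≤ x → ∃ s, 0 < s ∧ s ≤ a ∧ p s = x := by
    intro x hx
    have hev : ∀ᶠ s in 𝓝[>] (0 : ℝ), x < p s :=
      tendsto_weierstrassPRe_nhdsGT_zero.eventually (eventually_gt_atTop x)
    have hev2 : ∀ᶠ s in 𝓝[>] (0 : ℝ), s < a := mem_nhdsWithin_of_mem_nhds (Iio_mem_nhds ha0)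
    have hev3 : ∀ᶠ s in 𝓝[>] (0 : ℝ), s ∈ Ioi 0 := eventually_mem_nhdsWithin
    obtain ⟨s₁, hx₁, hs₁a, hs₁0⟩ := (hev.and (hev2.and hev3)).exists
    have hcont : ContinuousOn p (Icc s₁ a) := fun r hr ↦
      (hder r (lt_of_lt_of_le hs₁0 hr.1) (by linarith [hr.2])).continuousAt.continuousWithinAt
    obtain ⟨s, hs, hps⟩ := intermediate_value_Icc' hs₁a.le hcont ⟨hx, hx₁.le⟩
    exact ⟨s, lt_of_lt_of_le hs₁0 hs.1, hs.2, hps⟩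
  have hfnn : ∀ x, e ≤ x → 0 ≤ f x := by
    intro x hx
    obtain ⟨s, hs0, hsa, rfl⟩ := hrange x hx
    rw [← hsq s hs0 (by linarith)]
    positivity
  -- Grönwall consequence for a double root `v`: `f = 4(x − v)²(x + 2v)`
  have hgron : ∀ v c d K : ℝ, 0 < c → c ≤ d → d < Ω →
      L.g₂.re = 12 * v ^ 2 → L.g₃.re = -8 * v ^ 3 → p d = v →
      (∀ s ∈ Icc c d, 0 ≤ p s + 2 * v) → (∀ s ∈ Icc c d, p s ≤ K) → p c = v := by
    intro v c d K hc hcd hdΩ hA hB hpd hlow hup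
    have hK : 0 ≤ K + 2 * v := by
      have := hlow c ⟨le_rfl, hcd⟩; have := hup c ⟨le_rfl, hcd⟩; linarith
    refine eq_of_abs_deriv_le_mul_abs_sub (C := 2 * Real.sqrt (K + 2 * v))
      (fun s hs ↦ hder s (by linarith [hs.1]) (by linarith [hs.2])) ?_ hpd c ⟨le_rfl, hcd⟩
    intro s hs
    have hs0 : 0 < s := by linarith [hs.1]
    have hsΩ : s < Ω := by linarith [hs.2]
    have h1 : q s ^ 2 = (2 * |p s - v| * Real.sqrt (p s + 2 * v)) ^ 2 := by
      rw [hsq s hs0 hsΩ, mul_pow, mul_pow, sq_abs, Real.sq_sqrt (hlow s hs)]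
      simp only [hf, hA, hB]
      ring
    have h2 : |q s| = 2 * |p s - v| * Real.sqrt (p s + 2 * v) := by
      rw [← sq_eq_sq₀ (abs_nonneg _) (by positivity), sq_abs, h1]
    rw [h2]
    calc 2 * |p s - v| * Real.sqrt (p s + 2 * v)
        ≤ 2 * |p s - v| * Real.sqrt (K + 2 * v) := by
          gcongr
          exact hup s hs
      _ = 2 * Real.sqrt (K + 2 * v) * |p s - v| := by ring
  -- extrema of `p` on `[a, b]`
  have hcontab : ContinuousOn p (Icc a b) := fun s hs ↦
    (hder s (by linarith [hs.1]) (by linarith [hs.2])).continuousAt.continuousWithinAt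
  obtain ⟨tμ, htμ, hμ⟩ := isCompact_Icc.exists_isMinOn (nonempty_Icc.mpr hab.le) hcontab
  obtain ⟨tM, htM, hM⟩ := isCompact_Icc.exists_isMaxOn (nonempty_Icc.mpr hab.le) hcontab
  by_cases hcase1 : p tμ < e
  · -- Case 1: an interior minimum `μ < e`
    have htμa : a < tμ := by
      rcases htμ.1.eq_or_lt with h' | h'
      · exact absurd (h' ▸ hcase1) (lt_irrefl _)
      · exact h'
    have htμb : tμ < b := by
      rcases htμ.2.eq_or_lt with h' | h'
      · rw [h', hpb] at hcase1; exact absurd hcase1 (lt_irrefl _)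
      · exact h'
    have hlocmin : IsLocalMin p tμ := hμ.isLocalMin (Icc_mem_nhds htμa htμb)
    have hqμ : q tμ = 0 := hlocmin.hasDerivAt_eq_zero (hder tμ (by linarith) (by linarith))
    have hfμ : f (p tμ) = 0 := by rw [← hsq tμ (by linarith) (by linarith), hqμ]; ring
    have hfnn' : ∀ x, p tμ ≤ x → 0 ≤ f x := by
      intro x hx
      rcases le_or_gt e x with hxe | hxe
      · exact hfnn x hxe
      · have hc : ContinuousOn p (Icc a tμ) := hcontab.mono (Icc_subset_Icc le_rfl htμb.le)
        obtain ⟨s, hs, hps⟩ := intermediate_value_Icc' htμa.le hc ⟨hx, hxe.le⟩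
        rw [← hps, ← hsq s (by linarith [hs.1]) (by linarith [hs.2])]
        positivity
    obtain ⟨hA, hB, hμe⟩ := cubic_eq_of_roots_of_nonneg hcase1 hfμ hfe hfnn'
    have he0 : 0 < e := by linarith
    obtain ⟨K, hK⟩ : ∃ K, ∀ s ∈ Icc (a / 2) a, p s ≤ K := by
      have hc : ContinuousOn p (Icc (a / 2) a) := fun s hs ↦
        (hder s (by linarith [hs.1]) (by linarith [hs.2])).continuousAt.continuousWithinAt
      obtain ⟨K, hK⟩ := isCompact_Icc.bddAbove_image hc
      exact ⟨K, fun s hs ↦ hK ⟨s, hs, rfl⟩⟩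
    have hpa2 := hgron e (a / 2) a K (by linarith) (by linarith) (by linarith) hA hB rfl
      (fun s hs ↦ by have := hpge s (by linarith [hs.1]) hs.2; linarith) hK
    have hlt : p a < p (a / 2) := hpanti ⟨by linarith, by linarith⟩ ⟨ha0, le_rfl⟩ (by linarith)
    rw [hpa2] at hlt
    exact lt_irrefl _ hlt
  · have hge : ∀ s ∈ Icc a b, e ≤ p s := fun s hs ↦ (not_lt.mp hcase1).trans (hμ hs)
    by_cases hcase2 : e < p tM
    · -- Case 2: an interior maximum `M > e`
      have htMa : a < tM := by
        rcases htM.1.eq_or_lt with h' | h'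
        · exact absurd (h' ▸ hcase2) (lt_irrefl _)
        · exact h'
      have htMb : tM < b := by
        rcases htM.2.eq_or_lt with h' | h'
        · rw [h', hpb] at hcase2; exact absurd hcase2 (lt_irrefl _)
        · exact h'
      have hlocmax : IsLocalMax p tM := hM.isLocalMax (Icc_mem_nhds htMa htMb)
      have hqM : q tM = 0 := hlocmax.hasDerivAt_eq_zero (hder tM (by linarith) (by linarith))
      have hfM : f (p tM) = 0 := by rw [← hsq tM (by linarith) (by linarith), hqM]; ring
      obtain ⟨hA, hB, heM⟩ := cubic_eq_of_roots_of_nonneg hcase2 hfe hfM hfnn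
      have hpaM := hgron (p tM) a tM (p tM) ha0 htMa.le (by linarith) hA hB rfl
        (fun s hs ↦ by have := hge s ⟨hs.1, hs.2.trans htM.2⟩; linarith)
        (fun s hs ↦ hM ⟨hs.1, hs.2.trans htM.2⟩)
      exact absurd (he.trans hpaM) hcase2.ne
    · -- Case 3: `p ≡ e` on `[a, b]`, so `q ≡ 0` on `(a, b)`: impossible
      have hconst : ∀ s ∈ Icc a b, p s = e :=
        fun s hs ↦ le_antisymm ((hM hs).trans (not_lt.mp hcase2)) (hge s hs)
      have hq0 : ∀ s ∈ Ioo a b, q s = 0 := by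
        intro s hs
        have h1 : HasDerivAt p (q s) s := hder s (by linarith [hs.1]) (by linarith [hs.2])
        have h2 : HasDerivAt p 0 s := by
          refine (hasDerivAt_const s e).congr_of_eventuallyEq ?_
          filter_upwards [Ioo_mem_nhds hs.1 hs.2] with r hr
          exact hconst r (Ioo_subset_Icc_self hr)
        exact h1.unique h2
      exact h.not_derivWeierstrassPRe_eq_zero_on_Ioo ha0 hab hbΩ hq0

/-- **Monotonicity of `℘` on the real half-period** (Lawden §6.11, §6.15): for a real lattice
`t ↦ ℘(t)` is strictly decreasing on `(0, Ω₀/2]`. [folklore] -/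
theorem IsReal.strictAntiOn_weierstrassPRe (h : L.IsReal) :
    StrictAntiOn L.weierstrassPRe (Ioc 0 (L.minRealPeriod / 2)) := by
  have hΩ := h.minRealPeriod_pos
  refine strictAntiOn_of_deriv_neg (convex_Ioc 0 _) (fun s hs ↦ ?_) ?_
  · exact (hasDerivAt_weierstrassPRe
      (h.ofReal_notMem_lattice hs.1 (by linarith [hs.2]))).continuousAt.continuousWithinAt
  · rw [interior_Ioc]
    intro s hs
    rw [(hasDerivAt_weierstrassPRe (h.ofReal_notMem_lattice hs.1 (by linarith [hs.2]))).deriv]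
    exact h.derivWeierstrassPRe_neg hs.1 hs.2

/-- Discharge of the named fact `IsReal.strictAntiOn_weierstrassP` (Lawden §6.11, §6.15).
[cite: Lawden1989, §6.11 and §6.15] -/
theorem IsReal.strictAntiOn_weierstrassP_holds : IsReal.strictAntiOn_weierstrassP :=
  fun _ h ↦ ⟨h.strictAntiOn_weierstrassPRe, tendsto_weierstrassPRe_nhdsGT_zero⟩

/-! ### The real half-period as a complete elliptic integral -/

/-- The image of `(0, Ω₀/2)` under `℘` is `(e₁, ∞)`, `e₁ = ℘(Ω₀/2)` (Lawden §6.11: `℘` decreases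
from `+∞` to `e₁`). [folklore] -/
theorem IsReal.image_weierstrassPRe_Ioo (h : L.IsReal) :
    L.weierstrassPRe '' Ioo 0 (L.minRealPeriod / 2) =
      Ioi (L.weierstrassPRe (L.minRealPeriod / 2)) := by
  have hΩ := h.minRealPeriod_pos
  have hanti := h.strictAntiOn_weierstrassPRe
  apply Subset.antisymm
  · rintro _ ⟨s, hs, rfl⟩
    exact hanti ⟨hs.1, hs.2.le⟩ ⟨by linarith, le_rfl⟩ hs.2
  · intro x hx
    have hev : ∀ᶠ s in 𝓝[>] (0 : ℝ), x < L.weierstrassPRe s :=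
      tendsto_weierstrassPRe_nhdsGT_zero.eventually (eventually_gt_atTop x)
    have hev2 : ∀ᶠ s in 𝓝[>] (0 : ℝ), s < L.minRealPeriod / 2 :=
      mem_nhdsWithin_of_mem_nhds (Iio_mem_nhds (by linarith))
    have hev3 : ∀ᶠ s in 𝓝[>] (0 : ℝ), s ∈ Ioi 0 := eventually_mem_nhdsWithin
    obtain ⟨s₁, hx₁, hs₁, hs₁0⟩ := (hev.and (hev2.and hev3)).exists
    have hcont : ContinuousOn L.weierstrassPRe (Icc s₁ (L.minRealPeriod / 2)) := fun r hr ↦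
      (hasDerivAt_weierstrassPRe (h.ofReal_notMem_lattice (lt_of_lt_of_le hs₁0 hr.1)
        (by linarith [hr.2]))).continuousAt.continuousWithinAt
    obtain ⟨s, hs, hps⟩ := intermediate_value_Icc' hs₁.le hcont ⟨hx.le, hx₁.le⟩
    refine ⟨s, ⟨lt_of_lt_of_le hs₁0 hs.1, ?_⟩, hps⟩
    rcases hs.2.eq_or_lt with h' | h'
    · rw [h'] at hps; exact absurd hps hx.ne
    · exact h'

/-- **The real half-period as a complete elliptic integral** (Lawden (6.12.4), (6.17.4)):
`∫_{e₁}^{∞} (4x³ − g₂x − g₃)^{-1/2} dx = Ω₀/2` for a real lattice, `e₁ = ℘(Ω₀/2)`.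
Proof: change of variables `x = ℘(t)` on `(0, Ω₀/2)`, where `℘` is injective with derivative
`℘' = −√f(℘)`. [folklore] -/
theorem IsReal.integral_Ioi_inv_sqrt_cubic_eq (h : L.IsReal) :
    ∫ x in Ioi (L.weierstrassPRe (L.minRealPeriod / 2)),
        (Real.sqrt (4 * x ^ 3 - L.g₂.re * x - L.g₃.re))⁻¹ = L.minRealPeriod / 2 := by
  have hΩ := h.minRealPeriod_pos
  have hnot : ∀ s ∈ Ioo 0 (L.minRealPeriod / 2), (s : ℂ) ∉ L.lattice :=
    fun s hs ↦ h.ofReal_notMem_lattice hs.1 (by linarith [hs.2])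
  rw [← h.image_weierstrassPRe_Ioo,
    integral_image_eq_integral_abs_deriv_smul measurableSet_Ioo
      (fun s hs ↦ (hasDerivAt_weierstrassPRe (hnot s hs)).hasDerivWithinAt)
      (h.strictAntiOn_weierstrassPRe.injOn.mono Ioo_subset_Ioc_self)]
  have heq : EqOn (fun s ↦ |L.derivWeierstrassPRe s| •
      (Real.sqrt (4 * L.weierstrassPRe s ^ 3 - L.g₂.re * L.weierstrassPRe s - L.g₃.re))⁻¹)
      (fun _ ↦ (1 : ℝ)) (Ioo 0 (L.minRealPeriod / 2)) := by
    intro s hs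
    simp only [smul_eq_mul]
    rw [← h.derivWeierstrassPRe_sq (hnot s hs), Real.sqrt_sq_eq_abs,
      mul_inv_cancel₀ (abs_ne_zero.mpr (h.derivWeierstrassPRe_neg hs.1 hs.2).ne)]
  rw [setIntegral_congr_fun measurableSet_Ioo heq, setIntegral_const, smul_eq_mul, mul_one,
    Real.volume_real_Ioo_of_le (by linarith)]
  ring

/-- Discharge of the named fact `IsReal.integral_Ioi_inv_sqrt_cubic` (Lawden (6.12.4), (6.17.4)).
[cite: Lawden1989, eq. (6.12.4) and eq. (6.17.4)] -/
theorem IsReal.integral_Ioi_inv_sqrt_cubic_holds : IsReal.integral_Ioi_inv_sqrt_cubic :=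
  fun _ h ↦ h.integral_Ioi_inv_sqrt_cubic_eq

end PeriodPair

end
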